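import Mathlib
import Summits.Ventures.PercRepro2.Defs
import Summits.Ventures.PercRepro2.Graph
import Summits.Ventures.PercRepro2.OneColourSwitch
import Summits.Ventures.PercRepro2.RegionHubSign
import Summits.Ventures.PercRepro2.SideSwitch
import Summits.Ventures.PercRepro2.SideSwitchComps
import Summits.Ventures.PercRepro2.M9NoPocketDefs
import Summits.Ventures.PercRepro2.M9GeneralDSplit
import Summits.Ventures.PercRepro2.M9GeneralDHD
import Summits.Ventures.PercRepro2.M9PocketUnitKonly
import Summits.Ventures.PercRepro2.M9PocketHDTheorem
import Summits.Ventures.PercRepro2.M9PocketProdAssembly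
import Summits.Ventures.PercRepro2.M9PocketRSEdgeTransfer
import Summits.Ventures.PercRepro2.M9PocketRSEdgeSum

/-!
# Every neighbour of `r` or `s` adjacent to `d`, with arbitrary edges inside `{r, s}`
(blind cell PercRepro2, p3 g39, 2026-08-29; `proofs/P3-POCKETRK.md` §10″ (d))

The class of `dSignSum_nonpos_of_nbrs_adj_d` (every neighbour of `r` or `s` other than `r`,
`s`, `d` is a neighbour of `d`) without the hypothesis «no edge inside `{r, s}`»: such a graph
has no `r`–`s` path of `G − d` made of edges not inside `{r, s}` through non-neighbours of `d`
(its first vertex after `r` is a neighbour of `r`, hence of `d`), so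
`dSignSum_nonpos_of_sepN_restrict` applies; for `r = s` the sum vanishes (`σ_rr = 0`).
Own work; std axioms.
-/

namespace Summit.Ventures.PercRepro2

namespace NoPocket

open Finset Classical OneColourSwitch SideSwitch

variable {V : Type*} {E : Type*} {ends : E → Sym2 V} {p q r s d : V}
  [Fintype V] [DecidableEq V] [Fintype E] [DecidableEq E]

omit [Fintype V] [DecidableEq V] [Fintype E] [DecidableEq E] in
/-- `σ_rr = 0`. -/
lemma sigma_rr_zero (ω : Config E) (r : V) : sigma ends ω r r = 0 := by
  unfold sigma
  rw [if_pos (conn_refl _ _ _), if_pos (conn_refl _ _ _)]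
  norm_num

omit [Fintype V] [DecidableEq V] in
/-- With `r = s` the single-`d` sum vanishes. -/
lemma dSignSum_eq_zero_of_r_eq_s (h : r = s) : dSignSum ends p q r s d = 0 := by
  subst h
  unfold dSignSum
  refine Finset.sum_eq_zero fun ω _ => ?_
  rw [sigma_rr_zero, mul_zero, ite_self]

/-- **Every neighbour of `r` or `s` (other than `r`, `s`, `d`) adjacent to `d`, no `d r`,
`d s` edge, edges inside `{r, s}` arbitrary: `dSignSum ≤ 0`** — the class of
`dSignSum_nonpos_of_nbrs_adj_d` without «no edge inside `{r, s}`». -/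
theorem dSignSum_nonpos_of_nbrs_adj_d' (hdr : d ≠ r) (hds : d ≠ s)
    (hT : ∀ e, ends e ≠ s(d, r) ∧ ends e ≠ s(d, s))
    (hnb : ∀ e x, (ends e = s(r, x) ∨ ends e = s(s, x)) → x ≠ r → x ≠ s → x ≠ d →
      ∃ e', ends e' = s(d, x)) :
    dSignSum ends p q r s d ≤ 0 := by
  by_cases hrs : r = s
  · rw [dSignSum_eq_zero_of_r_eq_s hrs]
  refine dSignSum_nonpos_of_sepN_restrict hdr hds hT ?_
  intro hc
  -- no restricted edge through a non-neighbour of `d` leaves `r`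
  have hr : s ∈ ({r} : Set V) := by
    refine mem_of_conn_of_closed (S := ({r} : Set V)) ?_ rfl hc
    intro a ha b hab
    rw [Set.mem_singleton_iff] at ha ⊢
    rw [ha] at hab
    obtain ⟨hne, e', he', hends⟩ := openGraph_adj.1 hab
    rw [chi_eq_true_iff] at he'
    obtain ⟨x, hx, y, hy, hxy⟩ := he'
    have hde : d ∉ ends e'.1 := by
      intro hde
      rw [endsD_of_mem (ends := fun e : {e // e ∉ within ends ({r, s} : Set V)} => ends e.1)
        (e := e') hde, Sym2.eq_iff] at hends
      rcases hends with ⟨h1, _⟩ | ⟨_, h1⟩ <;> exact hdr h1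
    rw [endsD_of_notMem (ends := fun e : {e // e ∉ within ends ({r, s} : Set V)} => ends e.1)
      (e := e') hde] at hends hxy
    have hbs : b ≠ s := by
      rintro rfl
      exact e'.2 ⟨r, Or.inl rfl, b, Or.inr rfl, hends⟩
    have hbd : b ≠ d := by
      rintro rfl
      exact hde (by rw [hends]; exact Sym2.mem_mk_right _ _)
    obtain ⟨e'', he''⟩ := hnb e'.1 b (Or.inl hends) (Ne.symm hne) hbs hbd
    have hbN : ∀ e : {e // e ∉ within ends ({r, s} : Set V)}, ends e.1 ≠ s(d, b) := by
      rw [hends, Sym2.eq_iff] at hxy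
      rcases hxy with ⟨_, h2⟩ | ⟨_, h2⟩
      · rw [h2]; exact hy
      · rw [h2]; exact hx
    have he''F : e'' ∉ within ends ({r, s} : Set V) := by
      intro hF
      rcases (endpoint_of_mem_within hF he'').1 with h | h
      · exact hdr h
      · exact hds h
    exact (hbN ⟨e'', he''F⟩ he'').elim
  exact hrs (Set.mem_singleton_iff.1 hr).symm

end NoPocket

end Summit.Ventures.PercRepro2
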